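import Summits.ABC.ABC.Theorems.TwistAmplificationSharpModerateLawPlanarityFactorisationIdeals
import Mathlib.NumberTheory.NumberField.Units.DirichletTheorem

/-!
# Crux `TwistAmplification.SharpModerateLaw` (stmt-ABC-1975), line `unit-plane-conic-two-torsion`:
stub `stub_planarityFactorisation` — the PLANARITY FACTORISATION (the line's lever)

The registered stub `stub_planarityFactorisation : PlanarityFactorisation` (objects of
`…SharpModerateLawUnitPlaneDefs.lean` §4; helpers `…PlanarityFactorisationRing/Local/Ideals.lean`): for an
irreducible maximal form `F`, `O = R(F) ≅ 𝓞 K_F`, every coprime datum `(u, v)` with `F(u, v) ≠ 0` factors as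
`r²·(a u + v ω) = λ·β²` in `O` with `λ` from a finite SHAPE SET `Λ T`, `S ∣ |N β|`, `1 ≤ r ≤ C`, where
`#Λ T ≤ C·|Cl(O)[2]|·3^{ω(T)}` and `|N λ| ≤ C·T` (`T`, `S` the square-free kernel and square part of the flat
part `m♭` of `|F(u, v)|`; Kane, arXiv:1104.2635, Prop. 9, inside a maximal cubic order).

Proof (ideals of `O`, from `ideal_planarityFactorisation`: `(a u + v ω) = 𝔞'𝔟²`, `S ∣ N𝔟`, `N𝔞' ≤ M³T`,
`𝔞' = 𝔞'(w)·𝔞'_bad` with `𝔞'(w) = ∏_{q ∣ T} (q, ω + w_q)`, `w_q` a shape root, `N𝔞'_bad ≤ M³`):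
* CLASS REPRESENTATIVES (`classRep`, finite class group): `c = [𝔟]⁻¹`, `𝔯 = 𝔯_c`, `r = N𝔯 ∈ 𝔯`, `(r) = 𝔯·𝔰_c`;
  then `𝔟𝔯 = (β₀)` is principal and `(r²(au + vω)) = (𝔞'𝔰_c²)·(β₀²)`, so `r²(au + vω) = λ₀β₀²` with
  `(λ₀) = J := 𝔞'·𝔰_c²`, `N J = N𝔞'·r⁴`;
* GENERATORS (`gen`): `λ₀ = gen(J)·ε` for a unit `ε`;
* UNITS MODULO SQUARES (`unitReps`, Dirichlet's unit theorem in `𝓞 K_F` transported along `R(F) ≅ 𝓞 K_F`):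
  `ε = η·ε₁²` with `η` from a finite set; so `λ = gen(J)·η`, `β = β₀ε₁`;
* SHAPES (`shapeSet`): `λ` is the shape of the index `(w, 𝔞'_bad, c, η)`, `w ∈ ∏_{q ∣ T} shapeRoots F q`
  (`≤ 3^{ω(T)}` vectors, `card_shapeRoots_le_three`), `𝔞'_bad` of norm `≤ M³` (finitely many ideals), `c` a
  class, `η ∈ unitReps`; `#Λ T ≤ C·3^{ω(T)} ≤ C·|Cl[2]|·3^{ω(T)}` (`one_le_twoTorsionCard`), and the norm
  filter `|Nλ| ≤ C·T` holds for the datum's `λ` since `|Nλ| = N J ≤ M³T·R⁴`;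
  `C = leverConst F = 1 + R + #bad·h·#unitReps + M³R⁴` (`R = Σ_c r_c`).
-/

noncomputable section

-- the mandated summit namespace `Summit.ABC.ABC` (summit = problem) trips the duplicate-namespace linter
set_option linter.dupNamespace false

namespace Summit.ABC.ABC.Theorems.SharpModerateLaw.UnitPlane

open Literature.NumberTheory.CubicFields
open RingOfForm (omega theta RatAlgebra)

/-! ## 1. Shapes: class representatives, units modulo squares, generators -/

section Shapes

open NumberField NumberField.Units
open scoped nonZeroDivisors

variable {F : BinaryCubic ℤ} [hF : Fact F.IsIrreducible] [hM : Fact (RingOfForm.IsMaximal F)]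

/-! ### Class representatives -/

/-- A fixed nonzero integral ideal `𝔯_c` in each ideal class `c`. -/
def classRep (c : ClassGroup (RingOfForm F)) : (Ideal (RingOfForm F))⁰ := (ClassGroup.mk0_surjective c).choose

/-- `[𝔯_c] = c`. -/
theorem mk0_classRep (c : ClassGroup (RingOfForm F)) : ClassGroup.mk0 (classRep c) = c :=
  (ClassGroup.mk0_surjective c).choose_spec

/-- `r_c = N(𝔯_c)`. -/
def classNorm (c : ClassGroup (RingOfForm F)) : ℕ := Ideal.absNorm (classRep c : Ideal (RingOfForm F))

/-- `r_c > 0`. -/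
theorem classNorm_pos (c : ClassGroup (RingOfForm F)) : 0 < classNorm c := Ideal.absNorm_pos_of_nonZeroDivisors _

/-- `𝔯_c ∣ (r_c)` (`r_c ∈ 𝔯_c`). -/
theorem classRep_dvd_span (c : ClassGroup (RingOfForm F)) :
    (classRep c : Ideal (RingOfForm F)) ∣ Ideal.span {(classNorm c : RingOfForm F)} :=
  Ideal.dvd_span_singleton.mpr (Ideal.absNorm_mem _)

/-- The complementary ideal `𝔰_c` with `(r_c) = 𝔯_c · 𝔰_c`. -/
def coRep (c : ClassGroup (RingOfForm F)) : Ideal (RingOfForm F) := (classRep_dvd_span c).choose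

/-- `(r_c) = 𝔯_c · 𝔰_c`. -/
theorem span_classNorm (c : ClassGroup (RingOfForm F)) :
    Ideal.span {(classNorm c : RingOfForm F)} = classRep c * coRep c :=
  (classRep_dvd_span c).choose_spec

/-- `N(𝔰_c) = r_c²`. -/
theorem absNorm_coRep (c : ClassGroup (RingOfForm F)) : Ideal.absNorm (coRep c) = classNorm c ^ 2 := by
  have h := congrArg Ideal.absNorm (span_classNorm c)
  rw [Ideal.absNorm_span_natCast, RingOfForm.finrank_eq_three, map_mul] at h
  change classNorm c ^ 3 = classNorm c * Ideal.absNorm (coRep c) at h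
  have h' : classNorm c * Ideal.absNorm (coRep c) = classNorm c * classNorm c ^ 2 := by rw [← h]; ring
  exact Nat.eq_of_mul_eq_mul_left (classNorm_pos c) h'

variable (F) in
/-- `R = Σ_c r_c`, a bound for every `r_c`. -/
def classNormBound : ℕ :=
  ∑ c : ClassGroup (RingOfForm F), classNorm c

/-- `r_c ≤ R`. -/
theorem classNorm_le (c : ClassGroup (RingOfForm F)) : classNorm c ≤ classNormBound F :=
  Finset.single_le_sum (f := classNorm) (fun _ _ => Nat.zero_le _) (Finset.mem_univ c)

/-! ### Units modulo squares (Dirichlet) -/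

variable (F) in
/-- `R(F) ≅ 𝓞 K_F`. -/
def ringEquivInt :
    RingOfForm F ≃+* 𝓞 (RatAlgebra F) :=
  RingOfForm.ringEquivRingOfIntegers hM.out

open scoped Classical in
variable (F) in
/-- A finite set of units of `R(F)` representing `O^× / O^{×2}`: the images of `ζ · ∏ fᵢ^{δᵢ}`, `ζ` torsion,
`δ ∈ {0,1}^rank` (`fᵢ` a fundamental system of units of `K_F`). -/
def unitReps : Finset (RingOfForm F)ˣ :=
  haveI := Fintype.ofFinite (torsion (RatAlgebra F))
  (Finset.univ : Finset (torsion (RatAlgebra F) × (Fin (rank (RatAlgebra F)) → Fin 2))).image fun p =>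
    Units.mapEquiv (ringEquivInt F).symm.toMulEquiv
      ((p.1 : (𝓞 (RatAlgebra F))ˣ) * ∏ i, fundSystem (RatAlgebra F) i ^ (p.2 i : ℕ))

/-- **Every unit is a representative times a square** (Dirichlet's unit theorem: `ε = ζ ∏ fᵢ^{nᵢ}`,
`nᵢ = δᵢ + 2gᵢ`). -/
theorem exists_unitReps_mul_sq (ε : (RingOfForm F)ˣ) : ∃ η ∈ unitReps F, ∃ ε₁ : (RingOfForm F)ˣ, ε = η * ε₁ ^ 2 := by
  classical
  letI := Fintype.ofFinite (torsion (RatAlgebra F))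
  set K := RatAlgebra F
  set e := Units.mapEquiv (ringEquivInt F).symm.toMulEquiv with he
  obtain ⟨⟨ζ, n⟩, hx, -⟩ := exist_unique_eq_mul_prod K (e.symm ε)
  let δ : Fin (rank K) → Fin 2 := fun i => ⟨(n i % 2).toNat, by omega⟩
  let g : Fin (rank K) → ℤ := fun i => n i / 2
  have hn : ∀ i, n i = ((δ i : ℕ) : ℤ) + 2 * g i := fun i => by simp only [δ, g]; omega
  refine ⟨e ((ζ : (𝓞 K)ˣ) * ∏ i, fundSystem K i ^ (δ i : ℕ)), ?_, e (∏ i, fundSystem K i ^ g i), ?_⟩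
  · rw [unitReps]
    exact Finset.mem_image.mpr ⟨⟨ζ, δ⟩, Finset.mem_univ _, rfl⟩
  · rw [← map_pow, ← map_mul, ← MulEquiv.symm_apply_eq]
    simp only at hx
    rw [hx, mul_assoc, ← Finset.prod_pow, ← Finset.prod_mul_distrib]
    congr 1
    refine Finset.prod_congr rfl fun i _ => ?_
    rw [hn i, zpow_add, zpow_mul', zpow_natCast, zpow_ofNat]

omit hF hM in
/-- A unit has norm `±1`. -/
theorem natAbs_norm_unit (η : (RingOfForm F)ˣ) : (Algebra.norm ℤ (η : RingOfForm F)).natAbs = 1 :=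
  Int.isUnit_iff_natAbs_eq.mp ((Units.isUnit η).map (Algebra.norm ℤ))

/-! ### Generators of principal ideals -/

open scoped Classical in
/-- A fixed generator of a principal ideal (`0` for a non-principal one). -/
def gen (J : Ideal (RingOfForm F)) : RingOfForm F :=
  if h : J.IsPrincipal then @Submodule.IsPrincipal.generator _ _ _ _ _ J h else 0

omit hF hM in
/-- `(gen J) = J` for principal `J`. -/
theorem span_gen {J : Ideal (RingOfForm F)} (h : J.IsPrincipal) : Ideal.span {gen J} = J := by
  rw [gen, dif_pos h]
  exact Ideal.span_singleton_generator J

/-- `|N(gen J)| = N(J)` for principal `J`. -/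
theorem natAbs_norm_gen {J : Ideal (RingOfForm F)} (h : J.IsPrincipal) : (Algebra.norm ℤ (gen J)).natAbs = Ideal.absNorm J := by
  rw [← Ideal.absNorm_span_singleton, span_gen h]

/-! ### The shape sets `Λ T` -/

/-- The good ideal `∏_{q ∣ T} (q, ω + w_q)` of a residue vector `w`. -/
def goodIdeal (T : ℕ) (w : (q : ℕ) → q ∈ T.primeFactors → ℕ) : Ideal (RingOfForm F) :=
  ∏ q ∈ T.primeFactors.attach, primeIdealAt F q.1 (w q.1 q.2)

variable (F) in
/-- The ideals of norm `≤ M³` (a finite set: the bad parts `𝔞'_bad ∣ (M)`). -/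
def badIdeals : Finset (Ideal (RingOfForm F)) :=
  (Ideal.finite_setOf_absNorm_le (S := RingOfForm F) (badModulus F ^ 3)).toFinset

variable (F) in
/-- The index set of the shapes at level `T`: residue vectors × bad parts × ideal classes × unit representatives. -/
def shapeIndex (T : ℕ) :
    Finset (((((q : ℕ) → q ∈ T.primeFactors → ℕ) × Ideal (RingOfForm F)) × ClassGroup (RingOfForm F)) × (RingOfForm F)ˣ) :=
  (((T.primeFactors.pi fun q => shapeRoots F q) ×ˢ badIdeals F) ×ˢ Finset.univ) ×ˢ unitReps F

/-- The shape `gen(𝔞'(w)·𝔡·𝔰_c²)·η` of an index. -/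
def shapeOf (T : ℕ) (i : ((((q : ℕ) → q ∈ T.primeFactors → ℕ) × Ideal (RingOfForm F)) × ClassGroup (RingOfForm F)) × (RingOfForm F)ˣ) :
    RingOfForm F :=
  gen (goodIdeal T i.1.1.1 * i.1.1.2 * coRep i.1.2 ^ 2) * (i.2 : RingOfForm F)

variable (F) in
/-- The lever's constant `C(F) = 1 + R + #bad·h·#U₂ + M³R⁴`. -/
def leverConst : ℕ :=
  1 + classNormBound F + (badIdeals F).card * Fintype.card (ClassGroup (RingOfForm F)) * (unitReps F).card +
    badModulus F ^ 3 * classNormBound F ^ 4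

open scoped Classical in
variable (F) in
/-- **The shape set `Λ T`**: all shapes at level `T` of norm `≤ C·T`. -/
def shapeSet (T : ℕ) : Finset (RingOfForm F) :=
  ((shapeIndex F T).image (shapeOf T)).filter fun l => (Algebra.norm ℤ l).natAbs ≤ leverConst F * T

/-- **`#Λ T ≤ C · 3^{ω(T)}`** (at most three shape roots per prime). -/
theorem card_shapeSet_le (T : ℕ) : (shapeSet F T).card ≤ leverConst F * 3 ^ T.primeFactors.card := by
  classical
  have hpi : (T.primeFactors.pi fun q => shapeRoots F q).card ≤ 3 ^ T.primeFactors.card := by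
    rw [Finset.card_pi]
    exact Finset.prod_le_pow_card _ _ 3 fun q hq => card_shapeRoots_le_three F q (Nat.prime_of_mem_primeFactors hq)
  calc (shapeSet F T).card ≤ ((shapeIndex F T).image (shapeOf T)).card := Finset.card_filter_le _ _
    _ ≤ (shapeIndex F T).card := Finset.card_image_le
    _ = (T.primeFactors.pi fun q => shapeRoots F q).card *
          ((badIdeals F).card * Fintype.card (ClassGroup (RingOfForm F)) * (unitReps F).card) := by
        rw [shapeIndex, Finset.card_product, Finset.card_product, Finset.card_product, Finset.card_univ]; ring
    _ ≤ 3 ^ T.primeFactors.card * leverConst F := by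
        refine Nat.mul_le_mul hpi ?_
        unfold leverConst; omega
    _ = leverConst F * 3 ^ T.primeFactors.card := mul_comm _ _

/-- Norms on `Λ T` are `≤ C·T` (by construction). -/
theorem norm_le_of_mem_shapeSet {T : ℕ} {l : RingOfForm F} (hl : l ∈ shapeSet F T) :
    ((Algebra.norm ℤ l).natAbs : ℝ) ≤ leverConst F * T := by
  classical
  have h := (Finset.mem_filter.mp hl).2
  exact_mod_cast h

/-! ### The datum: `r²(a u + v ω) = λ β²` -/

/-- **The factorisation of a datum.** For coprime `(u, v)` with `F(u, v) ≠ 0` there are `λ ∈ Λ T`, `β` and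
`1 ≤ r ≤ C` with `r²(au + vω) = λβ²` and `S ∣ |Nβ|` (`T`, `S` the square-free kernel and square part of `m♭`). -/
theorem datum_factorisation {u v : ℤ} (huv : IsCoprime u v) (h0 : F.eval u v ≠ 0) :
    ∃ l ∈ shapeSet F (sqfreeKernel (coprimePart (badModulus F) (F.eval u v).natAbs)),
      ∃ β : RingOfForm F, ∃ r : ℕ, 1 ≤ r ∧ r ≤ leverConst F ∧
        ((r : RingOfForm F) ^ 2) * planeElt F u v = l * β ^ 2 ∧
        sqPart (coprimePart (badModulus F) (F.eval u v).natAbs) ∣ (Algebra.norm ℤ β).natAbs := by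
  classical
  set mf := coprimePart (badModulus F) (F.eval u v).natAbs with hmf
  set T := sqfreeKernel mf with hT
  set x := planeElt F u v with hx
  set 𝔟 := sqIdeal F u v with h𝔟
  set 𝔞 := oddIdeal F u v with h𝔞
  have h𝔟0 : 𝔟 ∈ (Ideal (RingOfForm F))⁰ := mem_nonZeroDivisors_of_ne_zero (by rw [Ideal.zero_eq_bot]; exact sqIdeal_ne_bot h0)
  -- the class `c = [𝔟]⁻¹` and its representative `𝔯`, `r = N𝔯`, `(r) = 𝔯 𝔰`
  set c : ClassGroup (RingOfForm F) := (ClassGroup.mk0 ⟨𝔟, h𝔟0⟩)⁻¹ with hc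
  set 𝔯 : Ideal (RingOfForm F) := (classRep c : Ideal (RingOfForm F)) with h𝔯
  set 𝔰 := coRep c with h𝔰
  set r := classNorm c with hr
  -- `𝔟 𝔯 = (β₀)` is principal
  have hprinc : (𝔟 * 𝔯).IsPrincipal := by
    have h1 : ClassGroup.mk0 (⟨𝔟, h𝔟0⟩ * classRep c) = 1 := by rw [map_mul, mk0_classRep, hc, mul_inv_cancel]
    exact (ClassGroup.mk0_eq_one_iff (Submonoid.mul_mem _ h𝔟0 (classRep c).2)).mp h1
  set β₀ := gen (𝔟 * 𝔯) with hβ₀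
  have hβ₀span : Ideal.span {β₀} = 𝔟 * 𝔯 := span_gen hprinc
  have hβ₀0 : β₀ ≠ 0 := by
    intro h
    have h𝔟𝔯 : 𝔟 * 𝔯 = ⊥ := by rw [← hβ₀span, h, Ideal.span_singleton_eq_bot]
    rcases Ideal.mul_eq_bot.mp h𝔟𝔯 with h' | h'
    · exact sqIdeal_ne_bot h0 h'
    · rw [← Ideal.zero_eq_bot] at h'
      exact nonZeroDivisors.ne_zero (classRep c).2 h'
  -- `(r² x) = 𝔞 𝔰² · (β₀²)`
  set J := 𝔞 * 𝔰 ^ 2 with hJ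
  have hspan : Ideal.span {(r : RingOfForm F) ^ 2 * x} = J * Ideal.span {β₀ ^ 2} := by
    calc Ideal.span {(r : RingOfForm F) ^ 2 * x} = Ideal.span {(r : RingOfForm F)} ^ 2 * Ideal.span {x} := by
          rw [← Ideal.span_singleton_mul_span_singleton, Ideal.span_singleton_pow]
      _ = (𝔯 * 𝔰) ^ 2 * (𝔞 * 𝔟 ^ 2) := by rw [hr, span_classNorm, hx, span_planeElt_eq h0]
      _ = 𝔞 * 𝔰 ^ 2 * (𝔟 * 𝔯) ^ 2 := by ring
      _ = J * Ideal.span {β₀ ^ 2} := by rw [← hβ₀span, Ideal.span_singleton_pow]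
  -- so `β₀² ∣ r² x`, `r² x = β₀² l₀` with `(l₀) = J`
  obtain ⟨l₀, hl₀⟩ : β₀ ^ 2 ∣ (r : RingOfForm F) ^ 2 * x := by
    rw [← Ideal.mem_span_singleton]
    have : (r : RingOfForm F) ^ 2 * x ∈ Ideal.span {(r : RingOfForm F) ^ 2 * x} := Ideal.mem_span_singleton_self _
    rw [hspan] at this
    exact Ideal.mul_le_left this
  have hJspan : Ideal.span {l₀} = J := by
    have h2 : Ideal.span {β₀ ^ 2} * Ideal.span {l₀} = Ideal.span {β₀ ^ 2} * J := by
      rw [Ideal.span_singleton_mul_span_singleton, ← hl₀, hspan, mul_comm]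
    exact mul_left_cancel₀ (by rw [Ideal.zero_eq_bot, Ne, Ideal.span_singleton_eq_bot]; exact pow_ne_zero 2 hβ₀0) h2
  have hJprinc : J.IsPrincipal := by rw [← hJspan]; exact ⟨l₀, rfl⟩
  -- `l₀ = gen J · ε`, `ε = η ε₁²`
  obtain ⟨ε, hε⟩ : Associated (gen J) l₀ := by
    rw [← Ideal.span_singleton_eq_span_singleton, span_gen hJprinc, hJspan]
  obtain ⟨η, hη, ε₁, hε₁⟩ := exists_unitReps_mul_sq ε
  -- the bad part and the residue vector of the datum
  have hbad : oddBadIdeal F u v ∈ badIdeals F := by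
    rw [badIdeals, Set.Finite.mem_toFinset]
    exact absNorm_oddBadIdeal_le h0
  set w : (q : ℕ) → q ∈ T.primeFactors → ℕ := fun q _ => residueAt F u v q with hw
  have hwpi : w ∈ T.primeFactors.pi fun q => shapeRoots F q := by
    rw [Finset.mem_pi]
    intro q hq
    obtain ⟨hqp, hqa, hqF⟩ := flatPrime_spec h0 (mem_primeFactors_sqfreeKernel.mp hq).1
    exact residueAt_mem_shapeRoots hqp hqa huv hqF
  have hgood : goodIdeal T w * oddBadIdeal F u v = 𝔞 := by
    rw [h𝔞, oddIdeal_eq huv h0, goodIdeal, ← hT]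
    congr 1
    exact Finset.prod_attach T.primeFactors fun q => primeIdealAt F q (residueAt F u v q)
  -- norms
  have hr1 : 1 ≤ r := classNorm_pos c
  have hrR : r ≤ classNormBound F := classNorm_le c
  have hRC : classNormBound F ≤ leverConst F := by unfold leverConst; omega
  have hNJ : Ideal.absNorm J ≤ badModulus F ^ 3 * classNormBound F ^ 4 * T := by
    rw [hJ, map_mul, map_pow, absNorm_coRep, ← pow_mul]
    calc Ideal.absNorm 𝔞 * r ^ (2 * 2) ≤ (badModulus F ^ 3 * T) * classNormBound F ^ (2 * 2) :=
          Nat.mul_le_mul (absNorm_oddIdeal_le huv h0) (Nat.pow_le_pow_left hrR _)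
      _ = badModulus F ^ 3 * classNormBound F ^ 4 * T := by ring
  have hMC : badModulus F ^ 3 * classNormBound F ^ 4 ≤ leverConst F := by unfold leverConst; omega
  -- the shape `l = gen J · η` and `β = β₀ ε₁`
  refine ⟨gen J * (η : RingOfForm F), ?_, β₀ * (ε₁ : RingOfForm F), r, hr1, hrR.trans hRC, ?_, ?_⟩
  · -- membership in `Λ T`
    rw [shapeSet, Finset.mem_filter]
    refine ⟨Finset.mem_image.mpr ⟨(((w, oddBadIdeal F u v), c), η), ?_, ?_⟩, ?_⟩
    · simp only [shapeIndex, Finset.mem_product, Finset.mem_univ, and_true]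
      exact ⟨⟨hwpi, hbad⟩, hη⟩
    · simp only [shapeOf, hJ, ← hgood, h𝔰]
    · rw [map_mul, Int.natAbs_mul, natAbs_norm_unit, mul_one, natAbs_norm_gen hJprinc]
      calc Ideal.absNorm J ≤ badModulus F ^ 3 * classNormBound F ^ 4 * T := hNJ
        _ ≤ leverConst F * T := Nat.mul_le_mul_right _ hMC
  · -- the identity `r² x = (gen J η) (β₀ ε₁)²`
    rw [hl₀, ← hε, hε₁]
    push_cast
    ring
  · -- `S ∣ |N β| = N𝔟 · r`
    rw [map_mul, Int.natAbs_mul, natAbs_norm_unit, mul_one, ← Ideal.absNorm_span_singleton, hβ₀span, map_mul]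
    exact (sqPart_dvd_absNorm_sqIdeal huv h0).mul_right _

end Shapes

/-! ## 2. The lever -/

/-- **PLANARITY FACTORISATION** (the lever of the line `unit-plane-conic-two-torsion`; registered stub
`stub_planarityFactorisation` of stmt-ABC-1975): for an irreducible maximal form `F`, with `C = leverConst F` and
`Λ = shapeSet F`, every coprime datum `(u, v)` factors as `r²(a u + v ω) = λ β²` with `λ ∈ Λ T`, `S ∣ |Nβ|`,
`1 ≤ r ≤ C`, where `#Λ T ≤ C·|Cl[2]|·3^{ω(T)}` and `|N λ| ≤ C·T` on `Λ T`. -/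
theorem stub_planarityFactorisation : PlanarityFactorisation := by
  intro F hirr hmax
  haveI : Fact F.IsIrreducible := ⟨hirr⟩
  haveI : Fact (RingOfForm.IsMaximal F) := ⟨hmax⟩
  refine ⟨leverConst F, shapeSet F, by unfold leverConst; omega, fun T => ?_, fun T l hl => norm_le_of_mem_shapeSet hl,
    fun u v huv h0 => datum_factorisation huv h0⟩
  have h1 := card_shapeSet_le (F := F) T
  have h2 := one_le_twoTorsionCard F hirr hmax
  have h3 : (shapeSet F T).card ≤ leverConst F * twoTorsionCard F * 3 ^ T.primeFactors.card :=
    h1.trans (Nat.mul_le_mul_right _ (Nat.le_mul_of_pos_right _ h2))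
  exact_mod_cast h3

end Summit.ABC.ABC.Theorems.SharpModerateLaw.UnitPlane

end
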